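import Literature.NumberTheory.DiophantineGeometry.AbcShapeExponents
import Literature.NumberTheory.DiophantineGeometry.AbcShapeGeometrySets

-- Summit.ABC.ABC is the mandated summit-side namespace (single-conjunct summit); the lakefile sets the same option tree-wide.
set_option linter.dupNamespace false

/-!
# The DE tool in exponent form (crux stmt-ABC-2757 `MazurKaneLaw`, line `critical-kloosterman-powerful-moduli`, lead c4)

The dictionary entry of the new fibre tool "DE" (ratio Cauchy–Schwarz modulo the host's power modulus + multiplicative
energy; blueprint `Cruxes/MazurKaneLaw/NOTES.md`). In multiplicative form the tool reads (host `W` with level set `Q`,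
modulus `q(w) = onVal Q w ≥ onVal Q W`, sides `U`, `V` with linear coordinate `i₀` and square coordinate `i₁`)

> `B² ≤ K · Dτ^e · (U₀V₀) · max(1, U₀V₀/onVal_Q W) · N_Q · (T₁ + T₂ + T₃ + T₄)`,

`N_Q = #subBox_Qᶜ W`, `N_C = #subBox_{i₀,i₁} U · #subBox_{i₀,i₁} V`, `S = 4U₁V₁`, `T₁ = N_Q N_C² S²/onVal_Q W`, `T₂ = N_Q N_C²`,
`T₃ = S N_Q N_C`, `T₄ = S N_C² N_Q^{1/2}` (the four terms of the energy bound). `dispersion_linear` turns it into the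
eight linear branches used by the linear programme: with `D = log_Λ B`, `ΣQ = Σ_{j∈Q} w_j`, `θ = Σ_{j∈Q} (j+1) w_j`,
`κ = (Σ u − u₀ − u₁) + (Σ v − v₀ − v₁)`, `P = u₁ + v₁`,
`2D ≤ (u₀+v₀) + [0 ∣ u₀+v₀−θ] + ΣQ + Eᵢ + loss`, `E₁ = ΣQ + 2κ + 2P − θ`, `E₂ = ΣQ + 2κ`, `E₃ = P + ΣQ + κ`,
`E₄ = P + 2κ + ΣQ/2`, `loss = log_Λ K + e log_Λ Dτ + 3 log_Λ 4`. Pattern: `sqrtLattice_linear`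
(`TwistAmplificationMazurKaneLawToolkitCertifiedLaw`). Pure real bookkeeping; no number theory.
-/

noncomputable section

open Finset
open Literature.NumberTheory.DiophantineGeometry
open Literature.NumberTheory.DiophantineGeometry.AbcShapes

namespace Summit.ABC.ABC.Theorems.MazurKaneLaw

/-- `log_Λ #subBox_Qᶜ W = Σ_{j ∈ Q} w_j`. [folklore] -/
theorem de_logb_card_subBox_compl {Λ : ℝ} {d : ℕ} (Q : Finset (Fin d)) {W : Fin d → ℕ} (hW : ∀ j, 0 < W j) :
    Real.logb Λ ((subBox Qᶜ W).card : ℝ) = ∑ j ∈ Q, expo Λ W j := by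
  classical
  rw [logb_card_subBox Qᶜ hW, sub_eq_iff_eq_add]
  exact (Finset.sum_add_sum_compl Q _).symm

/-- `log_Λ (#subBox_{i₀,i₁} U · #subBox_{i₀,i₁} V) = (Σ u − u₀ − u₁) + (Σ v − v₀ − v₁)` for `i₀ ≠ i₁`. [folklore] -/
theorem de_logb_card_cofactors {Λ : ℝ} {d : ℕ} {U V : Fin d → ℕ} (hU : ∀ j, 0 < U j) (hV : ∀ j, 0 < V j)
    {i₀ i₁ : Fin d} (h : i₀ ≠ i₁) :
    Real.logb Λ (((subBox ({i₀, i₁} : Finset (Fin d)) U).card : ℝ) * ((subBox ({i₀, i₁} : Finset (Fin d)) V).card : ℝ)) =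
      (∑ j, expo Λ U j - expo Λ U i₀ - expo Λ U i₁) + (∑ j, expo Λ V j - expo Λ V i₀ - expo Λ V i₁) := by
  classical
  have hcU : 0 < (subBox ({i₀, i₁} : Finset (Fin d)) U).card := by
    rw [card_subBox]; exact prod_pos fun j _ => hU j
  have hcV : 0 < (subBox ({i₀, i₁} : Finset (Fin d)) V).card := by
    rw [card_subBox]; exact prod_pos fun j _ => hV j
  rw [Real.logb_mul (by exact_mod_cast hcU.ne') (by exact_mod_cast hcV.ne'), logb_card_subBox _ hU,
    logb_card_subBox _ hV, sum_pair h, sum_pair h]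
  ring

/-- **The DE tool in exponent form** (registered sub-goal `dispersion_linear` of crux stmt-ABC-2757; statement verbatim, see the
module docstring for the reading). [folklore] -/
theorem dispersion_linear : ∀ {d : ℕ} {W U V : Fin d → ℕ}, (∀ j, 0 < W j) → (∀ j, 0 < U j) → (∀ j, 0 < V j) → ∀ {Dτ : ℕ}, 1 ≤ Dτ → ∀ {Λ : ℝ}, 1 < Λ → ∀ {B K : ℝ}, 0 < B → 1 ≤ K → ∀ (e : ℕ) (Q : Finset (Fin d)) (i₀ i₁ : Fin d), i₀ ≠ i₁ → B ^ 2 ≤ K * (Dτ : ℝ) ^ e * ((U i₀ : ℝ) * V i₀) * max 1 (((U i₀ : ℝ) * V i₀) / ((onVal Q W : ℕ) : ℝ)) * ((subBox Qᶜ W).card : ℝ) * (((subBox Qᶜ W).card : ℝ) * (((subBox ({i₀, i₁} : Finset (Fin d)) U).card : ℝ) * ((subBox ({i₀, i₁} : Finset (Fin d)) V).card : ℝ)) ^ 2 * (4 * ((U i₁ : ℝ) * V i₁)) ^ 2 / ((onVal Q W : ℕ) : ℝ) + ((subBox Qᶜ W).card : ℝ) * (((subBox ({i₀, i₁} : Finset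 (Fin d)) U).card : ℝ) * ((subBox ({i₀, i₁} : Finset (Fin d)) V).card : ℝ)) ^ 2 + (4 * ((U i₁ : ℝ) * V i₁)) * ((subBox Qᶜ W).card : ℝ) * (((subBox ({i₀, i₁} : Finset (Fin d)) U).card : ℝ) * ((subBox ({i₀, i₁} : Finset (Fin d)) V).card : ℝ)) + (4 * ((U i₁ : ℝ) * V i₁)) * (((subBox ({i₀, i₁} : Finset (Fin d)) U).card : ℝ) * ((subBox ({i₀, i₁} : Finset (Fin d)) V).card : ℝ)) ^ 2 * Real.sqrt ((subBox Qᶜ W).card : ℝ)) → (2 * Real.logb Λ B ≤ (expo Λ U i₀ + expo Λ V i₀) + 0 + ∑ j ∈ Q, expo Λ W j + (∑ j ∈ Q, expo Λ W j + 2 * ((∑ j, expo Λ U j - expo Λ U i₀ - expo Λ U i₁) + (∑ j, expo Λ V j - expo Λ V i₀ - expo Λ V i₁)) + 2 * (expo Λ U i₁ + expo Λ V i₁) - ∑ j ∈ Q, (((j : ℕ) : ℝ) + 1) * expo Λ W j) + (Real.logb Λ K + (e : ℝ) * Real.logb Λ Dτ + 3 * Real.logb Λ 4)) ∨ (2 *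 Real.logb Λ B ≤ (expo Λ U i₀ + expo Λ V i₀) + 0 + ∑ j ∈ Q, expo Λ W j + (∑ j ∈ Q, expo Λ W j + 2 * ((∑ j, expo Λ U j - expo Λ U i₀ - expo Λ U i₁) + (∑ j, expo Λ V j - expo Λ V i₀ - expo Λ V i₁))) + (Real.logb Λ K + (e : ℝ) * Real.logb Λ Dτ + 3 * Real.logb Λ 4)) ∨ (2 * Real.logb Λ B ≤ (expo Λ U i₀ + expo Λ V i₀) + 0 + ∑ j ∈ Q, expo Λ W j + ((expo Λ U i₁ + expo Λ V i₁) + ∑ j ∈ Q, expo Λ W j + ((∑ j, expo Λ U j - expo Λ U i₀ - expo Λ U i₁) + (∑ j, expo Λ V j - expo Λ V i₀ - expo Λ V i₁))) + (Real.logb Λ K + (e : ℝ) * Real.logb Λ Dτ + 3 * Real.logb Λ 4)) ∨ (2 * Real.logb Λ B ≤ (expo Λ U i₀ + expo Λ V i₀) + 0 + ∑ j ∈ Q, expo Λ W j + ((expo Λ U i₁ + expo Λ V i₁) + 2 * ((∑ j, expo Λ U j - expo Λ U i₀ - expo Λ U i₁) + (∑ j, expo Λ V j - expo Λ V i₀ -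 expo Λ V i₁)) + (∑ j ∈ Q, expo Λ W j) / 2) + (Real.logb Λ K + (e : ℝ) * Real.logb Λ Dτ + 3 * Real.logb Λ 4)) ∨ (2 * Real.logb Λ B ≤ (expo Λ U i₀ + expo Λ V i₀) + ((expo Λ U i₀ + expo Λ V i₀) - ∑ j ∈ Q, (((j : ℕ) : ℝ) + 1) * expo Λ W j) + ∑ j ∈ Q, expo Λ W j + (∑ j ∈ Q, expo Λ W j + 2 * ((∑ j, expo Λ U j - expo Λ U i₀ - expo Λ U i₁) + (∑ j, expo Λ V j - expo Λ V i₀ - expo Λ V i₁)) + 2 * (expo Λ U i₁ + expo Λ V i₁) - ∑ j ∈ Q, (((j : ℕ) : ℝ) + 1) * expo Λ W j) + (Real.logb Λ K + (e : ℝ) * Real.logb Λ Dτ + 3 * Real.logb Λ 4)) ∨ (2 * Real.logb Λ B ≤ (expo Λ U i₀ + expo Λ V i₀) + ((expo Λ U i₀ + expo Λ V i₀) - ∑ j ∈ Q, (((j : ℕ) : ℝ) + 1) * expo Λ W j) + ∑ j ∈ Q, expo Λ W j + (∑ j ∈ Q, expo Λ W j + 2 * ((∑ j, expo Λ U j - expo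 Λ U i₀ - expo Λ U i₁) + (∑ j, expo Λ V j - expo Λ V i₀ - expo Λ V i₁))) + (Real.logb Λ K + (e : ℝ) * Real.logb Λ Dτ + 3 * Real.logb Λ 4)) ∨ (2 * Real.logb Λ B ≤ (expo Λ U i₀ + expo Λ V i₀) + ((expo Λ U i₀ + expo Λ V i₀) - ∑ j ∈ Q, (((j : ℕ) : ℝ) + 1) * expo Λ W j) + ∑ j ∈ Q, expo Λ W j + ((expo Λ U i₁ + expo Λ V i₁) + ∑ j ∈ Q, expo Λ W j + ((∑ j, expo Λ U j - expo Λ U i₀ - expo Λ U i₁) + (∑ j, expo Λ V j - expo Λ V i₀ - expo Λ V i₁))) + (Real.logb Λ K + (e : ℝ) * Real.logb Λ Dτ + 3 * Real.logb Λ 4)) ∨ (2 * Real.logb Λ B ≤ (expo Λ U i₀ + expo Λ V i₀) + ((expo Λ U i₀ + expo Λ V i₀) - ∑ j ∈ Q, (((j : ℕ) : ℝ) + 1) * expo Λ W j) + ∑ j ∈ Q, expo Λ W j + ((expo Λ U i₁ + expo Λ V i₁) + 2 * ((∑ j, expo Λ U j - expo Λ U i₀ - expo Λ U i₁) + (∑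 j, expo Λ V j - expo Λ V i₀ - expo Λ V i₁)) + (∑ j ∈ Q, expo Λ W j) / 2) + (Real.logb Λ K + (e : ℝ) * Real.logb Λ Dτ + 3 * Real.logb Λ 4)) := by
  intro d W U V hW hU hV Dτ hDτ Λ hΛ B K hB hK e Q i₀ i₁ h01 hQ
  classical
  -- name the ingredients
  obtain ⟨NQ, hNQ⟩ : ∃ x : ℝ, x = ((subBox Qᶜ W).card : ℝ) := ⟨_, rfl⟩
  obtain ⟨NC, hNC⟩ : ∃ x : ℝ, x = (((subBox ({i₀, i₁} : Finset (Fin d)) U).card : ℝ) *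
    ((subBox ({i₀, i₁} : Finset (Fin d)) V).card : ℝ)) := ⟨_, rfl⟩
  obtain ⟨S4, hS4⟩ : ∃ x : ℝ, x = (4 * ((U i₁ : ℝ) * V i₁)) := ⟨_, rfl⟩
  obtain ⟨qm, hqm⟩ : ∃ x : ℝ, x = ((onVal Q W : ℕ) : ℝ) := ⟨_, rfl⟩
  obtain ⟨uv, huv⟩ : ∃ x : ℝ, x = ((U i₀ : ℝ) * V i₀) := ⟨_, rfl⟩
  rw [← hNC, ← hNQ, ← hS4, ← hqm, ← huv] at hQ
  -- positivity
  have hcpos : ∀ (S : Finset (Fin d)) {R : Fin d → ℕ}, (∀ j, 0 < R j) → (0 : ℝ) < (subBox S R).card :=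
    fun S R hR => by rw [card_subBox]; exact_mod_cast prod_pos fun j _ => hR j
  have hNQ0 : 0 < NQ := by rw [hNQ]; exact hcpos _ hW
  have hNC0 : 0 < NC := by rw [hNC]; exact mul_pos (hcpos _ hU) (hcpos _ hV)
  have hU0 : (0 : ℝ) < U i₀ := by exact_mod_cast hU i₀
  have hV0 : (0 : ℝ) < V i₀ := by exact_mod_cast hV i₀
  have hU1 : (0 : ℝ) < U i₁ := by exact_mod_cast hU i₁
  have hV1 : (0 : ℝ) < V i₁ := by exact_mod_cast hV i₁
  have hS40 : 0 < S4 := by rw [hS4]; exact mul_pos (by norm_num) (mul_pos hU1 hV1)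
  have hon : 0 < onVal Q W := prod_pos fun j _ => pow_pos (hW j) _
  have hqm0 : 0 < qm := by rw [hqm]; exact_mod_cast hon
  have huv0 : 0 < uv := by rw [huv]; exact mul_pos hU0 hV0
  have hDτ' : (0 : ℝ) < Dτ := by exact_mod_cast hDτ
  have hK0 : 0 < K := by linarith
  have hl4 : 0 ≤ Real.logb Λ 4 := Real.logb_nonneg hΛ (by norm_num)
  -- logarithms of the ingredients
  have hlNQ : Real.logb Λ NQ = ∑ j ∈ Q, expo Λ W j := by rw [hNQ]; exact de_logb_card_subBox_compl Q hW
  have hlNC : Real.logb Λ NC = (∑ j, expo Λ U j - expo Λ U i₀ - expo Λ U i₁) +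
      (∑ j, expo Λ V j - expo Λ V i₀ - expo Λ V i₁) := by rw [hNC]; exact de_logb_card_cofactors hU hV h01
  have hlS4 : Real.logb Λ S4 = Real.logb Λ 4 + (expo Λ U i₁ + expo Λ V i₁) := by
    rw [hS4, Real.logb_mul (by norm_num) (mul_pos hU1 hV1).ne', Real.logb_mul hU1.ne' hV1.ne']
    simp only [expo]
  have hlqm : Real.logb Λ qm = ∑ j ∈ Q, (((j : ℕ) : ℝ) + 1) * expo Λ W j := by
    rw [hqm, logb_onVal Q hW]
  have hluv : Real.logb Λ uv = expo Λ U i₀ + expo Λ V i₀ := by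
    rw [huv, Real.logb_mul hU0.ne' hV0.ne']
    simp only [expo]
  have hlsq : Real.logb Λ (Real.sqrt NQ) = (∑ j ∈ Q, expo Λ W j) / 2 := by
    rw [Real.sqrt_eq_rpow, Real.logb_rpow_eq_mul_logb_of_pos hNQ0, hlNQ]
    ring
  have hlB2 : Real.logb Λ (B ^ 2) = 2 * Real.logb Λ B := by
    rw [← Real.rpow_natCast, Real.logb_rpow_eq_mul_logb_of_pos hB]
    norm_num
  have hlDe : Real.logb Λ ((Dτ : ℝ) ^ e) = (e : ℝ) * Real.logb Λ Dτ := by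
    rw [← Real.rpow_natCast, Real.logb_rpow_eq_mul_logb_of_pos hDτ']
  -- the four terms and the max
  obtain ⟨T₁, hT₁⟩ : ∃ T : ℝ, T = NQ * NC ^ 2 * S4 ^ 2 / qm := ⟨_, rfl⟩
  obtain ⟨T₂, hT₂⟩ : ∃ T : ℝ, T = NQ * NC ^ 2 := ⟨_, rfl⟩
  obtain ⟨T₃, hT₃⟩ : ∃ T : ℝ, T = S4 * NQ * NC := ⟨_, rfl⟩
  obtain ⟨T₄, hT₄⟩ : ∃ T : ℝ, T = S4 * NC ^ 2 * Real.sqrt NQ := ⟨_, rfl⟩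
  have hT₁0 : 0 < T₁ := by rw [hT₁]; exact div_pos (mul_pos (mul_pos hNQ0 (pow_pos hNC0 2)) (pow_pos hS40 2)) hqm0
  have hT₂0 : 0 < T₂ := by rw [hT₂]; exact mul_pos hNQ0 (pow_pos hNC0 2)
  have hT₃0 : 0 < T₃ := by rw [hT₃]; exact mul_pos (mul_pos hS40 hNQ0) hNC0
  have hT₄0 : 0 < T₄ := by rw [hT₄]; exact mul_pos (mul_pos hS40 (pow_pos hNC0 2)) (Real.sqrt_pos.mpr hNQ0)
  have hlT₁ : Real.logb Λ T₁ = ∑ j ∈ Q, expo Λ W j + 2 * Real.logb Λ NC + 2 * Real.logb Λ S4 - Real.logb Λ qm := by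
    rw [hT₁, Real.logb_div (mul_pos (mul_pos hNQ0 (pow_pos hNC0 2)) (pow_pos hS40 2)).ne' hqm0.ne',
      Real.logb_mul (mul_pos hNQ0 (pow_pos hNC0 2)).ne' (pow_pos hS40 2).ne',
      Real.logb_mul hNQ0.ne' (pow_pos hNC0 2).ne', ← Real.rpow_natCast NC, ← Real.rpow_natCast S4,
      Real.logb_rpow_eq_mul_logb_of_pos hNC0, Real.logb_rpow_eq_mul_logb_of_pos hS40, hlNQ]
    push_cast; ring
  have hlT₂ : Real.logb Λ T₂ = ∑ j ∈ Q, expo Λ W j + 2 * Real.logb Λ NC := by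
    rw [hT₂, Real.logb_mul hNQ0.ne' (pow_pos hNC0 2).ne', ← Real.rpow_natCast NC,
      Real.logb_rpow_eq_mul_logb_of_pos hNC0, hlNQ]
    push_cast; ring
  have hlT₃ : Real.logb Λ T₃ = Real.logb Λ S4 + ∑ j ∈ Q, expo Λ W j + Real.logb Λ NC := by
    rw [hT₃, Real.logb_mul (mul_pos hS40 hNQ0).ne' hNC0.ne', Real.logb_mul hS40.ne' hNQ0.ne', hlNQ]
  have hlT₄ : Real.logb Λ T₄ = Real.logb Λ S4 + 2 * Real.logb Λ NC + (∑ j ∈ Q, expo Λ W j) / 2 := by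
    rw [hT₄, Real.logb_mul (mul_pos hS40 (pow_pos hNC0 2)).ne' (Real.sqrt_pos.mpr hNQ0).ne', Real.logb_mul hS40.ne' (pow_pos hNC0 2).ne',
      ← Real.rpow_natCast NC, Real.logb_rpow_eq_mul_logb_of_pos hNC0, hlsq]
    push_cast; ring
  -- the common factor `G = K Dτ^e uv M NQ` with `M = max 1 (uv/qm)` and its logarithm in the two cases
  obtain ⟨M, hM⟩ : ∃ M : ℝ, M = max 1 (uv / qm) := ⟨_, rfl⟩
  have hM1 : 1 ≤ M := by rw [hM]; exact le_max_left _ _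
  have hM0 : 0 < M := by linarith
  obtain ⟨G, hG⟩ : ∃ G : ℝ, G = K * (Dτ : ℝ) ^ e * uv * M * NQ := ⟨_, rfl⟩
  have hG0 : 0 < G := by rw [hG]; exact mul_pos (mul_pos (mul_pos (mul_pos hK0 (pow_pos hDτ' e)) huv0) hM0) hNQ0
  have hlG : Real.logb Λ G = Real.logb Λ K + (e : ℝ) * Real.logb Λ Dτ + (expo Λ U i₀ + expo Λ V i₀) +
      Real.logb Λ M + ∑ j ∈ Q, expo Λ W j := by
    rw [hG, Real.logb_mul (mul_pos (mul_pos (mul_pos hK0 (pow_pos hDτ' e)) huv0) hM0).ne' hNQ0.ne',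
      Real.logb_mul (mul_pos (mul_pos hK0 (pow_pos hDτ' e)) huv0).ne' hM0.ne',
      Real.logb_mul (mul_pos hK0 (pow_pos hDτ' e)).ne' huv0.ne', Real.logb_mul hK0.ne' (pow_pos hDτ' e).ne', hlDe, hluv, hlNQ]
  have hlM : Real.logb Λ M = 0 ∨ Real.logb Λ M = (expo Λ U i₀ + expo Λ V i₀) - ∑ j ∈ Q, (((j : ℕ) : ℝ) + 1) * expo Λ W j := by
    rcases le_or_gt (uv / qm) 1 with h1 | h1
    · left; rw [hM, max_eq_left h1, Real.logb_one]
    · right; rw [hM, max_eq_right h1.le, Real.logb_div huv0.ne' hqm0.ne', hluv, hlqm]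
  -- `B² ≤ G · (T₁+T₂+T₃+T₄) ≤ G · 4 · T_max`
  have hQ' : B ^ 2 ≤ G * (T₁ + T₂ + T₃ + T₄) := by rw [hG, hM, hT₁, hT₂, hT₃, hT₄]; exact hQ
  have key : ∀ Tm : ℝ, 0 < Tm → T₁ ≤ Tm → T₂ ≤ Tm → T₃ ≤ Tm → T₄ ≤ Tm →
      2 * Real.logb Λ B ≤ Real.logb Λ G + Real.logb Λ 4 + Real.logb Λ Tm := by
    intro Tm hTm h1 h2 h3 h4
    have hsum : T₁ + T₂ + T₃ + T₄ ≤ 4 * Tm := by linarith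
    have hle : B ^ 2 ≤ G * 4 * Tm := by
      calc B ^ 2 ≤ G * (T₁ + T₂ + T₃ + T₄) := hQ'
        _ ≤ G * (4 * Tm) := mul_le_mul_of_nonneg_left hsum hG0.le
        _ = G * 4 * Tm := by ring
    have h := Real.logb_le_logb_of_le hΛ (pow_pos hB 2) hle
    rw [hlB2, Real.logb_mul (mul_pos hG0 (by norm_num)).ne' hTm.ne', Real.logb_mul hG0.ne' (by norm_num)] at h
    exact h
  -- which term is the largest
  rcases le_total T₂ T₁ with h21 | h12
  · rcases le_total T₃ T₁ with h31 | h13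
    · rcases le_total T₄ T₁ with h41 | h14
      · -- T₁ max
        have h := key T₁ hT₁0 le_rfl h21 h31 h41
        rw [hlG, hlT₁, hlNC, hlS4, hlqm] at h
        rcases hlM with hm | hm <;> rw [hm] at h
        · left; linarith
        · right; right; right; right; left; linarith
      · -- T₄ max
        have h := key T₄ hT₄0 h14 (h21.trans h14) (h31.trans h14) le_rfl
        rw [hlG, hlT₄, hlNC, hlS4] at h
        rcases hlM with hm | hm <;> rw [hm] at h
        · right; right; right; left; linarith
        · right; right; right; right; right; right; right; linarith
    · rcases le_total T₄ T₃ with h43 | h34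
      · -- T₃ max
        have h := key T₃ hT₃0 h13 (h21.trans h13) le_rfl h43
        rw [hlG, hlT₃, hlNC, hlS4] at h
        rcases hlM with hm | hm <;> rw [hm] at h
        · right; right; left; linarith
        · right; right; right; right; right; right; left; linarith
      · -- T₄ max
        have h := key T₄ hT₄0 (h13.trans h34) ((h21.trans h13).trans h34) h34 le_rfl
        rw [hlG, hlT₄, hlNC, hlS4] at h
        rcases hlM with hm | hm <;> rw [hm] at h
        · right; right; right; left; linarith
        · right; right; right; right; right; right; right; linarith
  · rcases le_total T₃ T₂ with h32 | h23
    · rcases le_total T₄ T₂ with h42 | h24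
      · -- T₂ max
        have h := key T₂ hT₂0 h12 le_rfl h32 h42
        rw [hlG, hlT₂, hlNC] at h
        rcases hlM with hm | hm <;> rw [hm] at h
        · right; left; linarith [hl4]
        · right; right; right; right; right; left; linarith [hl4]
      · -- T₄ max
        have h := key T₄ hT₄0 (h12.trans h24) h24 (h32.trans h24) le_rfl
        rw [hlG, hlT₄, hlNC, hlS4] at h
        rcases hlM with hm | hm <;> rw [hm] at h
        · right; right; right; left; linarith
        · right; right; right; right; right; right; right; linarith
    · rcases le_total T₄ T₃ with h43 | h34
      · -- T₃ max
        have h := key T₃ hT₃0 (h12.trans h23) h23 le_rfl h43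
        rw [hlG, hlT₃, hlNC, hlS4] at h
        rcases hlM with hm | hm <;> rw [hm] at h
        · right; right; left; linarith
        · right; right; right; right; right; right; left; linarith
      · -- T₄ max
        have h := key T₄ hT₄0 ((h12.trans h23).trans h34) (h23.trans h34) h34 le_rfl
        rw [hlG, hlT₄, hlNC, hlS4] at h
        rcases hlM with hm | hm <;> rw [hm] at h
        · right; right; right; left; linarith
        · right; right; right; right; right; right; right; linarith

end Summit.ABC.ABC.Theorems.MazurKaneLaw

end
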